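import Literature.Analysis.FluidPDE.HardSphereCollisionRecord
import Literature.Analysis.FluidPDE.HardSphereFreeStretch
import Literature.Analysis.FluidPDE.HardSphereDynamicsProofs
import Literature.MathematicalPhysics.KineticTheory.HardSphereEuler
import HarnessLib

/-!
# Per-particle free stretch (`stub_perParticleFreeStretch`, registered stub S1 of the line
# `Sketch` for the crux `JParityClosure.RateFloor`, stmt-AtomisticToContinuum-13080)

The kinematic base of the line: along a hard-sphere trajectory `γ` (`IsHardSphereTrajectory`,
right-continuous, binary collisions from pre-collisional left limits), a particle `k` that takes
part in no collision during `(s, t]` sits, at time `t`, on its own free flight issued from `γ s`,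
whatever the OTHER particles did in between:
`γ t k = freeFlight G (t - s) (γ s) k`.

Proof (general geometry `G` over a Hausdorff position space with continuous translations, then
specialised to the flat torus `𝕋³`, `Torus.continuous_geometry_translate`): strong induction on
the (finite, `locFinite`) number of collision times of the WHOLE system in `(s, t]`.
* No collision time in `(s, t]`: the field `free`.
* Otherwise let `τ` be the least collision time in `(s, t]`. The interval `(s, τ)` is
  collision-free, so the left limit of `γ` at `τ` is `freeFlight G (τ - s) (γ s)`
  (`IsHardSphereTrajectory.leftLim_eq_freeFlight`); at `τ` the value is the elastic reflection
  `collidePair G i j (leftLim γ τ)` of the colliding pair `{i, j}`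
  (`IsHardSphereTrajectory.eq_collidePair_leftLim`), and `k ∉ {i, j}` because `k` does not
  participate at `τ` (`IsHardSphereTrajectory.participates_iff`), so
  `γ τ k = leftLim γ τ k = freeFlight G (τ - s) (γ s) k` (`collidePair_apply_of_ne`). The
  induction hypothesis on `(τ, t]` (one collision time fewer) gives
  `γ t k = freeFlight G (t - τ) (γ τ) k`, and the free flight of particle `k` only depends on
  `γ τ k` (`freeFlight_apply`, `freeFlight_add`).

References: folklore (GST 2013 §4.1, Def. 4.1.2: the hard-sphere dynamics is free transport
between the collisions of each particle).
-/

noncomputable section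

namespace Summit.AtomisticToContinuum.HydrodynamicLimit.Theorems

open MeasureTheory Set Filter Topology
open Literature.Analysis.FluidPDE Literature.MathematicalPhysics.KineticTheory

namespace RateFloorPerParticleFreeStretch

variable {d : Type*} [Fintype d] {X : Type*} [TopologicalSpace X] {N : ℕ}
  {G : Geometry d X} {ε : ℝ} {γ : ℝ → Config N d X}

omit [TopologicalSpace X] in
/-- The free flight of particle `k` only depends on the state of particle `k`. [folklore] -/
theorem freeFlight_apply_congr {z z' : Config N d X} {k : Fin N} (hk : z k = z' k) (u : ℝ) :
    freeFlight G u z k = freeFlight G u z' k := by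
  simp only [freeFlight_apply, hk]

/-- At a collision time `τ` at which `k` does not participate, preceded by the collision-free
interval `(s, τ)`, particle `k` is on its free flight from `γ s`: the value at `τ` is the
elastic reflection of the left limit, which does not touch `k`. [folklore] -/
theorem apply_eq_freeFlight_of_not_participates [T2Space X] (h : IsHardSphereTrajectory G ε N γ)
    (hG : ∀ x : X, Continuous (G.translate x)) {s τ : ℝ} {k : Fin N} (hsτ : s < τ)
    (hfree : ∀ σ ∈ Ioo s τ, σ ∉ collisionTimes G ε γ)
    (hk : ¬ Participates G ε (γ τ) k) :
    γ τ k = freeFlight G (τ - s) (γ s) k := by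
  have hleft : Function.leftLim γ τ = freeFlight G (τ - s) (γ s) :=
    h.leftLim_eq_freeFlight hG hsτ hfree
  by_cases hτ : τ ∈ collisionTimes G ε γ
  · obtain ⟨i, j, hij, hc⟩ := hτ
    have hp : (i, j) ∈ contactPairs G ε (γ τ) := mem_contactPairs.2 ⟨hij, hc⟩
    have hki : k ≠ i := fun hki => hk ((h.participates_iff hp).2 (Or.inl hki))
    have hkj : k ≠ j := fun hkj => hk ((h.participates_iff hp).2 (Or.inr hkj))
    rw [(h.eq_collidePair_leftLim hij hc).2, collidePair_apply_of_ne hki hkj, hleft]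
  · rw [h.free s τ hsτ.le fun σ hσ => ?_]
    rcases hσ.2.eq_or_lt with rfl | hlt
    · exact hτ
    · exact hfree σ ⟨hσ.1, hlt⟩

/-- **Per-particle free stretch**, general geometry: if particle `k` participates in no
collision during `(s, t]`, then `γ t k = freeFlight G (t - s) (γ s) k` (strong induction on
the number of collision times of the whole system in `(s, t]`). [folklore] -/
theorem apply_eq_freeFlight_of_forall_not_mem_collisionTimesOf [T2Space X]
    (h : IsHardSphereTrajectory G ε N γ) (hG : ∀ x : X, Continuous (G.translate x))
    {s t : ℝ} {k : Fin N} (hst : s ≤ t)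
    (hk : ∀ u ∈ Ioc s t, u ∉ collisionTimesOf G ε γ k) :
    γ t k = freeFlight G (t - s) (γ s) k := by
  -- strong induction on the number `n` of collision times in `(s, t]`, the start `s` varying
  suffices H : ∀ (n : ℕ) (s : ℝ), (collisionTimes G ε γ ∩ Ioc s t).ncard = n → s ≤ t →
      (∀ u ∈ Ioc s t, u ∉ collisionTimesOf G ε γ k) →
      γ t k = freeFlight G (t - s) (γ s) k from H _ s rfl hst hk
  intro n
  induction n using Nat.strong_induction_on with
  | _ n ih =>
    intro s hn hst hk
    have hfin : (collisionTimes G ε γ ∩ Ioc s t).Finite :=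
      h.finite_collisionTimes_inter_of_subset_Icc Ioc_subset_Icc_self
    rcases (collisionTimes G ε γ ∩ Ioc s t).eq_empty_or_nonempty with hemp | hne
    · -- no collision at all in `(s, t]`: free flight of the whole system
      rw [h.free s t hst fun σ hσ hcol => ?_]
      have hmem : σ ∈ collisionTimes G ε γ ∩ Ioc s t := ⟨hcol, hσ⟩
      rw [hemp] at hmem
      exact hmem
    · -- `τ` the least collision time in `(s, t]`
      obtain ⟨τ, ⟨hτcol, hτI⟩, hτmin⟩ := Set.exists_min_image _ id hfin hne
      have hfree : ∀ σ ∈ Ioo s τ, σ ∉ collisionTimes G ε γ := fun σ hσ hσcol =>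
        (not_lt.2 (hτmin σ ⟨hσcol, hσ.1, hσ.2.le.trans hτI.2⟩)) hσ.2
      -- particle `k` at time `τ`
      have hγτk : γ τ k = freeFlight G (τ - s) (γ s) k :=
        apply_eq_freeFlight_of_not_participates h hG hτI.1 hfree
          fun hP => hk τ hτI (mem_collisionTimesOf.2 hP)
      -- induction hypothesis on `(τ, t]`
      have hsub : collisionTimes G ε γ ∩ Ioc τ t ⊆ collisionTimes G ε γ ∩ Ioc s t :=
        fun σ hσ => ⟨hσ.1, hτI.1.trans hσ.2.1, hσ.2.2⟩
      have hlt : (collisionTimes G ε γ ∩ Ioc τ t).ncard < n := by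
        rw [← hn]
        refine Set.ncard_lt_ncard ((Set.ssubset_iff_of_subset hsub).2 ?_) hfin
        exact ⟨τ, ⟨hτcol, hτI⟩, fun hτ' => lt_irrefl τ hτ'.2.1⟩
      have hih : γ t k = freeFlight G (t - τ) (γ τ) k :=
        ih _ hlt τ rfl hτI.2 fun u hu => hk u ⟨hτI.1.trans hu.1, hu.2⟩
      rw [hih, freeFlight_apply_congr hγτk, ← freeFlight_add]
      congr 1
      ring

/-- Registered stub S1 (`Stubs.stub_perParticleFreeStretch` of the line `Sketch`, verbatim):
**per-particle free stretch** on the flat torus `𝕋³`. A particle of a hard-sphere trajectory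
that takes part in no collision during `(s, t]` is, at time `t`, on its free flight issued from
`γ s`, whatever the other particles do. [folklore] -/
theorem stub_perParticleFreeStretch :
    ∀ (N : ℕ) (ε : ℝ) (γ : ℝ → Config N (Fin 3) T3),
    IsHardSphereTrajectory (Torus.geometry (Fin 3)) ε N γ →
    ∀ (s t : ℝ) (k : Fin N), s ≤ t →
      (∀ u ∈ Set.Ioc s t, u ∉ collisionTimesOf (Torus.geometry (Fin 3)) ε γ k) →
      γ t k = freeFlight (Torus.geometry (Fin 3)) (t - s) (γ s) k :=
  fun _N _ε _γ h _s _t _k hst hk =>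
    apply_eq_freeFlight_of_forall_not_mem_collisionTimesOf h Torus.continuous_geometry_translate
      hst hk

end RateFloorPerParticleFreeStretch

end Summit.AtomisticToContinuum.HydrodynamicLimit.Theorems

end
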